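import Literature.Barriers.Parity.SiegelZeroDichotomyPairHLProp81Bulk
import Literature.Barriers.Parity.SiegelZeroDichotomyPairHLProp81Sum
import Literature.Barriers.Parity.SiegelZeroDichotomyPairHLProp81Prelim
import HarnessLib

/-!
# Tao–Teräväinen 2022, Proposition 8.1 (`k = 2`): the sum over `n ≤ x`, modulo the Euler-product asymptotic

Topic `Literature/Barriers/Parity`, sub-namespace `TaoTeravainen`; assembly of Proposition 8.1 in the proof
DAG of `Literature.Barriers.Parity.TaoTeravainen2021_prop72_81_pair` (T. Tao, J. Teräväinen, *The
Hardy–Littlewood–Chowla conjecture in the presence of a Siegel zero*, J. London Math. Soc. (2) 106 (2022),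
arXiv:2109.06291), §8: "Proposition 8.1. … `𝔼_{n≤x} Λ♯(n+h₁)⋯Λ♯(n+h_k) ≈ 𝔖`" — here for `k = 2` and
at the level of the SUM `∑_{n≤x} Λ♯(n+h₁)Λ♯(n+h₂)`, with every parameter explicit and the
Euler-product asymptotic (the comparison of `∏_{p<N} E_p(τ)` with `𝔖' ∏_j ∏_{p<N}(1 − p^{-s(τ_{j,0})})`,
cf. `SiegelZeroDichotomyPairHLProp81Bulk.lean`) entering as the hypothesis `hK`/`herrW`.
Everything here is PROVED:

* `abs_smoothPointwise_sub_le_real` — the real form of `norm_smoothPointwise_sub_le` at a bulk point;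
* `crude_smoothPointwise_bound` — `|G(n)| ≤ M_crude` from `abs_smoothPointwise_le`, `abs_psiSharp_le`;
* **`abs_sharpCorr_sub_le_of_euler`** — `|∑_{n≤x} Λ♯(n+h₁)Λ♯(n+h₂) − 𝔖' x| ≤ E_χ + E_CRT + (ε_K + |𝔖'|(2ε+ε²)) x
  + (M_crude + |𝔖'|) x₁`, the bulk being `x₁ < n ≤ x`. [cite: TaoTeravainen2021, Proposition 8.1 and §8 (8.5)–(8.8)]
-/

noncomputable section

open Finset Real MeasureTheory Complex
open scoped FourierTransform

namespace Literature.Barriers.Parity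

namespace TaoTeravainen

variable {q : ℕ}

/-- **(8.8) at a bulk integer point, real form.** [cite: TaoTeravainen2021, §8 (8.8)] -/
theorem abs_smoothPointwise_sub_le_real (χ : DirichletCharacter ℂ q) (hχ : χ.IsQuadratic) {φ ψ : ℝ → ℝ}
    (hφ : IsBump φ) (hψ : IsSmoothCutoff ψ) {M : ℕ → ℝ} (hM : ∀ i u, |iteratedDeriv i ψ u| ≤ M i)
    {X U₀ : ℝ} (hU₀ : 1 ≤ U₀) (hX : 2 * U₀ + 2 ≤ X) (hX3 : 3 * U₀ ≤ X) {R : ℝ} (hR : 1 < R)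
    {h₁ h₂ : ℕ} (hne : h₁ ≠ h₂) {n : ℕ} (hn : 1 ≤ n)
    (hc : ∀ j : Fin 2, Real.log ((n : ℝ) + (if j = 0 then h₁ else h₂ : ℕ)) ≤ X + 1)
    {δ : ℝ} (hδ : 0 < δ)
    (hbulk₁ : ∀ w ∈ Set.Ioo (Real.log ((n : ℝ) + h₁) - δ) (Real.log ((n : ℝ) + h₁) + δ), psiLog φ ψ X U₀ w = w)
    (hbulk₂ : ∀ w ∈ Set.Ioo (Real.log ((n : ℝ) + h₂) - δ) (Real.log ((n : ℝ) + h₂) + δ), psiLog φ ψ X U₀ w = w)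
    {Dmax A N : ℕ} (hA : 1 ≤ A) (hAD : Dmax < 2 ^ (A + 1)) (hN : max Dmax ⌈R⌉₊ < N)
    (hΨ₁ : ∀ d : ℕ, Dmax < d → psiSharp φ ψ X U₀ (((n : ℝ) + h₁) / d) = 0)
    (hΨ₂ : ∀ d : ℕ, Dmax < d → psiSharp φ ψ X U₀ (((n : ℝ) + h₂) / d) = 0)
    {C₀ : ℝ} (hC₀ : 1 ≤ C₀) (hζ₀ : ∀ σ : ℂ, ‖σ‖ ≤ 1 → ‖riemannZeta₀ (1 + σ)‖ ≤ C₀) {τ₀ : ℝ} (hτ₀ : 0 < τ₀)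
    (hsmall : X⁻¹ + 2 * π * τ₀ ≤ 1 / (2 * C₀)) {nn : ℕ} (hnn : 3 ≤ nn)
    {S' : ℝ} {err : (Slot → ℝ) → ℝ} (herrW : Integrable fun τ => err τ * ‖sixWeight φ ψ X U₀ h₁ h₂ n τ‖)
    (hK : ∀ τ : Slot → ℝ,
      ‖(∏ p ∈ Nat.primesBelow N, MainTerm.localE p ((shiftDiff h₁ h₂).factorization p) A (realChar χ p)
          (fun j => npow (slotExpo X R (j, 0) (τ (j, 0))) p)
          (fun j => npow (slotExpo X R (j, 1) (τ (j, 1))) p)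
          (fun j => npow (slotExpo X R (j, 2) (τ (j, 2))) p)) -
        (S' : ℂ) * ∏ j : Fin 2, eulerTrunc N (zetaSlotS X (τ (j, 0)))‖ ≤ err τ)
    {εK : ℝ} (hεK : ∫ τ, err τ * ‖sixWeight φ ψ X U₀ h₁ h₂ n τ‖ ≤ εK) :
    |smoothPointwise χ φ ψ X U₀ R h₁ h₂ Dmax n - S'| ≤
      εK + |S'| * (2 * moebiusSlotErr M X U₀ C₀ τ₀ nn + moebiusSlotErr M X U₀ C₀ τ₀ nn ^ 2) := by
  have hy : (0 : ℝ) < n := by exact_mod_cast hn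
  have h := norm_smoothPointwise_sub_le χ hχ hφ hψ hM hU₀ hX hX3 hR hne hy hc hδ hbulk₁ hbulk₂ hA hAD hN hΨ₁ hΨ₂
    hC₀ hζ₀ hτ₀ hsmall hnn herrW hK hεK
  rw [← Complex.ofReal_sub, Complex.norm_real, Real.norm_eq_abs] at h
  rwa [Complex.norm_real, Real.norm_eq_abs] at h

/-- **The crude bound `|G(y)| ≤ M_crude`** with `M_crude = sup|ψ|⁴ |h₁−h₂| (2 sup|ψ| sup|φ| (L+1))² S₁(T)²`
whenever `|log((y+h_j)/t)| ≤ L` on the triples (`L ≥ 0`). [cite: TaoTeravainen2021, §8 ("The contribution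
of those `y` with `y ≤ x^{1−ε₀²}`")] -/
theorem crude_smoothPointwise_bound (χ : DirichletCharacter ℂ q) {φ ψ : ℝ → ℝ} (hφ : IsBump φ)
    {B₀ Bψ : ℝ} (hB₀ : ∀ u, |φ u| ≤ B₀) (hBψ : ∀ u, |ψ u| ≤ Bψ) (X U₀ R : ℝ) {h₁ h₂ : ℕ} (hne : h₁ ≠ h₂)
    (Dmax : ℕ) (y : ℝ) {L : ℝ} (hL0 : 0 ≤ L)
    (hL₁ : ∀ t ∈ sharpTriples R Dmax, |Real.log ((y + h₁) / t.1)| ≤ L)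
    (hL₂ : ∀ t ∈ sharpTriples R Dmax, |Real.log ((y + h₂) / t.1)| ≤ L) :
    |smoothPointwise χ φ ψ X U₀ R h₁ h₂ Dmax y| ≤
      Bψ ^ 4 * (Int.natAbs ((h₁ : ℤ) - h₂) : ℝ) * (2 * Bψ * B₀ * (L + 1)) ^ 2 *
        (tripleGcdSum 1 (sharpTriples R Dmax)) ^ 2 := by
  have hB₀0 : 0 ≤ B₀ := (abs_nonneg _).trans (hB₀ 0)
  have hBψ0 : 0 ≤ Bψ := (abs_nonneg _).trans (hBψ 0)
  have hM : 0 ≤ 2 * Bψ * B₀ * (L + 1) := by positivity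
  refine abs_smoothPointwise_le χ φ hBψ X U₀ R hne Dmax y hM (fun t ht => ?_) (fun t ht => ?_)
  · exact (abs_psiSharp_le hφ hB₀ hBψ X U₀ _).trans (by gcongr; exact hL₁ t ht)
  · exact (abs_psiSharp_le hφ hB₀ hBψ X U₀ _).trans (by gcongr; exact hL₂ t ht)

/-- `|log((n+h)/t)| ≤ L` for `1 ≤ t ≤ D_max`, `1 ≤ n + h ≤ x + h` when `log D_max ≤ L` and `log(x+h) ≤ L`.
[folklore] -/
theorem abs_log_div_le {n h x Dmax t : ℕ} (hn1 : 1 ≤ n) (hnx : n ≤ x) (ht1 : 1 ≤ t) (htD : t ≤ Dmax) {L : ℝ}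
    (hLD : Real.log Dmax ≤ L) (hLx : Real.log ((x + h : ℕ) : ℝ) ≤ L) :
    |Real.log ((((n : ℝ) + h)) / t)| ≤ L := by
  have ht0 : (0 : ℝ) < t := by exact_mod_cast ht1
  have hnh : (1 : ℝ) ≤ (n : ℝ) + h := by
    have : (1 : ℝ) ≤ n := by exact_mod_cast hn1
    have : (0 : ℝ) ≤ h := Nat.cast_nonneg h
    linarith
  have hD1 : (1 : ℝ) ≤ Dmax := by exact_mod_cast ht1.trans htD
  rw [abs_le, Real.log_div (by linarith) ht0.ne']
  constructor
  · -- lower bound: `log(n+h) ≥ 0`, `log t ≤ log Dmax ≤ L`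
    have h1 : 0 ≤ Real.log ((n : ℝ) + h) := Real.log_nonneg hnh
    have h2 : Real.log t ≤ Real.log Dmax := Real.log_le_log ht0 (by exact_mod_cast htD)
    linarith
  · have h1 : Real.log ((n : ℝ) + h) ≤ Real.log ((x + h : ℕ) : ℝ) := by
      refine Real.log_le_log (by linarith) ?_
      push_cast; gcongr
    have h2 : 0 ≤ Real.log t := Real.log_nonneg (by exact_mod_cast ht1)
    linarith

/-- `moebiusSlotErr ≥ 0`. [folklore] -/
theorem moebiusSlotErr_nonneg {M : ℕ → ℝ} (hM : ∀ i, 0 ≤ M i) {X U₀ C₀ τ₀ : ℝ} (hX : 0 ≤ X) (hU₀ : 0 < U₀)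
    (hC₀ : 0 ≤ C₀) (hτ₀ : 0 ≤ τ₀) (n : ℕ) : 0 ≤ moebiusSlotErr M X U₀ C₀ τ₀ n := by
  unfold moebiusSlotErr
  have h0 : 0 ≤ cutoffDerivSum M 0 := Finset.sum_nonneg fun i _ => hM i
  have hn : 0 ≤ cutoffDerivSum M n := Finset.sum_nonneg fun i _ => hM i
  positivity

/-- **Proposition 8.1 at `k = 2`, sum level, modulo the Euler-product asymptotic.** With the parameters
and hypotheses listed (cutoff data; `2 ≤ U₀`, `2U₀ + 2 ≤ X`, `3U₀ ≤ X`; `R > 1`; `h₁ ≠ h₂`; the ranges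
`log(x + h_j) ≤ X + 1`, `log(x + h_j) + δ ≤ X + U₀ − 1` and the bulk threshold `X − U₀ + 1 + δ ≤ log(x₁+1)`;
`D_max` beyond the supports; `A ≥ 1`, `D_max < 2^{A+1}`, `N > max(D_max, ⌈R⌉)`; the `ζ` data; the crude
level `L`; the `χ`-twisted error `E_χ` as the hypothesis `hχ` (the output of `abs_sharpCorr_sub_smooth_le`);
and the Euler-product asymptotic `hK` with `∫ err ‖W_n‖ ≤ ε_K` for every bulk `n`),
`|∑_{n≤x} Λ♯(n+h₁)Λ♯(n+h₂) − 𝔖' x| ≤ E_χ + sup|ψ|⁴K_Ψ²#T_D² + (ε_K + |𝔖'|(2ε+ε²)) x + (M_crude + |𝔖'|) x₁`.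
[cite: TaoTeravainen2021, Proposition 8.1 and §8 (8.5)–(8.8)] -/
theorem abs_sharpCorr_sub_le_of_euler (χ : DirichletCharacter ℂ q) (hχq : χ.IsQuadratic) {φ ψ : ℝ → ℝ}
    (hφ : IsBump φ) (hψ : IsSmoothCutoff ψ) {B₀ B₁ Bψ : ℝ} (hB₀ : ∀ u, |φ u| ≤ B₀) (hB₁ : ∀ u, |deriv φ u| ≤ B₁)
    (hBψ : ∀ u, |ψ u| ≤ Bψ) {M : ℕ → ℝ} (hM : ∀ i u, |iteratedDeriv i ψ u| ≤ M i)
    {X U₀ : ℝ} (hU₀ : 2 ≤ U₀) (hX : 2 * U₀ + 2 ≤ X) (hX3 : 3 * U₀ ≤ X) {R : ℝ} (hR : 1 < R)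
    {h₁ h₂ : ℕ} (hne : h₁ ≠ h₂) {x₁ x : ℕ} (hx₁ : x₁ ≤ x)
    (hxX₁ : Real.log ((x + h₁ : ℕ) : ℝ) ≤ X + 1) (hxX₂ : Real.log ((x + h₂ : ℕ) : ℝ) ≤ X + 1)
    {δ : ℝ} (hδ : 0 < δ) (hlo : X - U₀ + 1 + δ ≤ Real.log ((x₁ + 1 : ℕ) : ℝ))
    (hhi₁ : Real.log ((x + h₁ : ℕ) : ℝ) + δ ≤ X + U₀ - 1) (hhi₂ : Real.log ((x + h₂ : ℕ) : ℝ) + δ ≤ X + U₀ - 1)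
    {Dmax : ℕ} (hDmax₁ : Real.exp (Real.log ((x + h₁ : ℕ) : ℝ) - X + 2 * U₀ + 1) ≤ Dmax)
    (hDmax₂ : Real.exp (Real.log ((x + h₂ : ℕ) : ℝ) - X + 2 * U₀ + 1) ≤ Dmax)
    {A N : ℕ} (hA : 1 ≤ A) (hAD : Dmax < 2 ^ (A + 1)) (hN : max Dmax ⌈R⌉₊ < N)
    {C₀ : ℝ} (hC₀ : 1 ≤ C₀) (hζ₀ : ∀ σ : ℂ, ‖σ‖ ≤ 1 → ‖riemannZeta₀ (1 + σ)‖ ≤ C₀) {τ₀ : ℝ} (hτ₀ : 0 < τ₀)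
    (hsmall : X⁻¹ + 2 * π * τ₀ ≤ 1 / (2 * C₀)) {nn : ℕ} (hnn : 3 ≤ nn)
    {L : ℝ} (hL0 : 0 ≤ L) (hLD : Real.log Dmax ≤ L) (hLx₁ : Real.log ((x + h₁ : ℕ) : ℝ) ≤ L)
    (hLx₂ : Real.log ((x + h₂ : ℕ) : ℝ) ≤ L)
    {Eχ : ℝ}
    (hχ : |∑ n ∈ Icc 1 x, vonMangoldtSiegelSharp χ φ ψ X U₀ R (n + h₁) * vonMangoldtSiegelSharp χ φ ψ X U₀ R (n + h₂) -
        ∑ n ∈ Icc 1 x, (sharpB χ φ ψ X U₀ Dmax (n + h₁) * selbergSieve ψ R (n + h₁)) *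
          (sharpB χ φ ψ X U₀ Dmax (n + h₂) * selbergSieve ψ R (n + h₂))| ≤ Eχ)
    {S' : ℝ} {err : (Slot → ℝ) → ℝ}
    (hK : ∀ τ : Slot → ℝ,
      ‖(∏ p ∈ Nat.primesBelow N, MainTerm.localE p ((shiftDiff h₁ h₂).factorization p) A (realChar χ p)
          (fun j => npow (slotExpo X R (j, 0) (τ (j, 0))) p)
          (fun j => npow (slotExpo X R (j, 1) (τ (j, 1))) p)
          (fun j => npow (slotExpo X R (j, 2) (τ (j, 2))) p)) -
        (S' : ℂ) * ∏ j : Fin 2, eulerTrunc N (zetaSlotS X (τ (j, 0)))‖ ≤ err τ)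
    {εK : ℝ} (hεK0 : 0 ≤ εK)
    (herrW : ∀ n ∈ Icc (x₁ + 1) x, Integrable (fun τ => err τ * ‖sixWeight φ ψ X U₀ h₁ h₂ n τ‖) ∧
      ∫ τ, err τ * ‖sixWeight φ ψ X U₀ h₁ h₂ n τ‖ ≤ εK) :
    |∑ n ∈ Icc 1 x, vonMangoldtSiegelSharp χ φ ψ X U₀ R (n + h₁) * vonMangoldtSiegelSharp χ φ ψ X U₀ R (n + h₂) -
        S' * x| ≤
      Eχ + Bψ ^ 4 * (psiAbelConst B₀ B₁ Bψ X) ^ 2 * (#(sharpTriples R Dmax) : ℝ) ^ 2 +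
        ((εK + |S'| * (2 * moebiusSlotErr M X U₀ C₀ τ₀ nn + moebiusSlotErr M X U₀ C₀ τ₀ nn ^ 2)) * x +
          (Bψ ^ 4 * (Int.natAbs ((h₁ : ℤ) - h₂) : ℝ) * (2 * Bψ * B₀ * (L + 1)) ^ 2 *
              (tripleGcdSum 1 (sharpTriples R Dmax)) ^ 2 + |S'|) * x₁) := by
  have hU₀1 : 1 ≤ U₀ := by linarith
  have hU₀0 : 0 < U₀ := by linarith
  have hX0 : 0 ≤ X := by linarith
  have hM0 : ∀ i, 0 ≤ M i := fun i => (abs_nonneg _).trans (hM i 0)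
  have hεm0 := moebiusSlotErr_nonneg (C₀ := C₀) hM0 hX0 hU₀0 (by linarith) hτ₀.le nn
  -- monotonicity helpers in `n`
  have hlog_le : ∀ {n : ℕ} (h : ℕ), n ≤ x → Real.log ((n : ℝ) + h) ≤ Real.log ((x + h : ℕ) : ℝ) := by
    intro n h hnx
    by_cases h0 : (n : ℝ) + h = 0
    · rw [h0, Real.log_zero]; exact Real.log_natCast_nonneg _
    · refine Real.log_le_log (lt_of_le_of_ne (by positivity) (Ne.symm h0)) ?_
      push_cast; gcongr
  -- (8.7): smooth correlation vs `∑ G(n)`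
  have hcrt := abs_smoothCorr_sub_sum_pointwise_le χ hφ hψ hB₀ hB₁ hBψ hU₀ (by linarith) hR hxX₁ hxX₂ Dmax
  -- the bulk
  have hbulk : ∀ n ∈ Icc (x₁ + 1) x, |smoothPointwise χ φ ψ X U₀ R h₁ h₂ Dmax n - S'| ≤
      εK + |S'| * (2 * moebiusSlotErr M X U₀ C₀ τ₀ nn + moebiusSlotErr M X U₀ C₀ τ₀ nn ^ 2) := by
    intro n hn
    rw [mem_Icc] at hn
    have hn1 : 1 ≤ n := by omega
    have hc : ∀ j : Fin 2, Real.log ((n : ℝ) + (if j = 0 then h₁ else h₂ : ℕ)) ≤ X + 1 := by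
      intro j; fin_cases j
      · simpa using (hlog_le h₁ hn.2).trans hxX₁
      · simpa using (hlog_le h₂ hn.2).trans hxX₂
    have hlo' : ∀ h : ℕ, X - U₀ + 1 ≤ Real.log ((n : ℝ) + h) - δ := by
      intro h
      have : Real.log ((x₁ + 1 : ℕ) : ℝ) ≤ Real.log ((n : ℝ) + h) := by
        refine Real.log_le_log (by positivity) ?_
        push_cast
        have : ((x₁ : ℝ) + 1) ≤ n := by exact_mod_cast hn.1
        have : (0 : ℝ) ≤ h := Nat.cast_nonneg h
        linarith
      linarith
    have hbulkj : ∀ h : ℕ, Real.log ((x + h : ℕ) : ℝ) + δ ≤ X + U₀ - 1 →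
        ∀ w ∈ Set.Ioo (Real.log ((n : ℝ) + h) - δ) (Real.log ((n : ℝ) + h) + δ), psiLog φ ψ X U₀ w = w := by
      intro h hhi w hw
      exact psiLog_eq_self_of_mem hφ hψ hU₀0 hX3 (hlo' h) (by linarith [hlog_le h hn.2]) hw
    have hΨj : ∀ h : ℕ, Real.exp (Real.log ((x + h : ℕ) : ℝ) - X + 2 * U₀ + 1) ≤ Dmax →
        ∀ d : ℕ, Dmax < d → psiSharp φ ψ X U₀ (((n : ℝ) + h) / d) = 0 := by
      intro h hD d hd
      have hyh : 0 < (n : ℝ) + h := by positivity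
      refine psiSharp_div_eq_zero_of_lt hφ hψ hU₀0 hyh (lt_of_le_of_lt ?_ (show (Dmax : ℝ) < d by exact_mod_cast hd))
      exact (Real.exp_le_exp.mpr (by linarith [hlog_le h hn.2])).trans hD
    obtain ⟨hint, hle⟩ := herrW n (mem_Icc.mpr hn)
    exact abs_smoothPointwise_sub_le_real χ hχq hφ hψ hM hU₀1 hX hX3 hR hne hn1 hc hδ (hbulkj h₁ hhi₁) (hbulkj h₂ hhi₂)
      hA hAD hN (hΨj h₁ hDmax₁) (hΨj h₂ hDmax₂) hC₀ hζ₀ hτ₀ hsmall hnn hint hK hle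
  -- the crude range
  have hcrude : ∀ n ∈ Icc 1 x₁, |smoothPointwise χ φ ψ X U₀ R h₁ h₂ Dmax n| ≤
      Bψ ^ 4 * (Int.natAbs ((h₁ : ℤ) - h₂) : ℝ) * (2 * Bψ * B₀ * (L + 1)) ^ 2 * (tripleGcdSum 1 (sharpTriples R Dmax)) ^ 2 := by
    intro n hn
    rw [mem_Icc] at hn
    refine crude_smoothPointwise_bound χ hφ hB₀ hBψ X U₀ R hne Dmax n hL0 (fun t ht => ?_) (fun t ht => ?_)
    · rw [mem_sharpTriples] at ht
      exact abs_log_div_le hn.1 (hn.2.trans hx₁) ht.1.1 ht.1.2 hLD hLx₁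
    · rw [mem_sharpTriples] at ht
      exact abs_log_div_le hn.1 (hn.2.trans hx₁) ht.1.1 ht.1.2 hLD hLx₂
  have hε0 : 0 ≤ εK + |S'| * (2 * moebiusSlotErr M X U₀ C₀ τ₀ nn + moebiusSlotErr M X U₀ C₀ τ₀ nn ^ 2) :=
    add_nonneg hεK0 (mul_nonneg (abs_nonneg _) (by nlinarith [hεm0]))
  exact abs_sharpCorr_sub_singular_mul_le χ φ ψ X U₀ R h₁ h₂ Dmax hx₁ hε0 hχ hcrt hbulk hcrude

end TaoTeravainen

end Literature.Barriers.Parity
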